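import Literature.NumberTheory.Automorphic.AutomorphyFactorForms
import Literature.AlgebraicGeometry.ShimuraVarieties.UnitaryBallConeChart
import Literature.Geometry.ComplexHyperbolic.UnitBallJacobian
import HarnessLib

/-!
# Automorphic holomorphic forms on the ball attached to a ball-quotient datum

Topic `AlgebraicGeometry/ShimuraVarieties`; namespace
`Literature.AlgebraicGeometry.ShimuraVarieties` (ball-model material in the grouping sub-namespace
`BallForms`, datum API dotted on `UnitaryBallUniformisationDatum`). Everything here is a definition or a
PROVED lemma (Mathlib + tree).

On the tree's affine ball `𝔹² = BallModel.Ball` with its `U(2,1)`-action and Jacobian cocycle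
`BallModel.Jac` (`Jac_mul`, `Jac_one`):

* the **cotangent cocycle** `BallForms.cotangentCocycle g z = (Jac g z)ᵀ` and the **canonical
  cocycles** `BallForms.canonicalCocycle V k g z = (det Jac g z)ᵏ • 1` are pullback cocycles in the
  sense of `AutomorphyFactor.IsPullbackCocycle` (so `factorForms Δ _`, `toGroup`, `factorFormsEquiv`
  of `AutomorphyFactorForms` apply): a `Δ`-automorphic form for the cotangent cocycle is a function
  `F : 𝔹² → ℂ²` with `F z = (Jac γ z)ᵀ F (γ z)`, i.e. the coefficient vector of a `Δ`-invariant
  `(1,0)`-form `F₀ dz₀ + F₁ dz₁`; for the canonical cocycle of weight `k`, `F z = (det Jac γ z)ᵏ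
  F (γ z)`, i.e. a `Δ`-invariant section of `K^{⊗k}` (`k = 1`: invariant `(2,0)`-forms
  `F dz₀ ∧ dz₁`) (Borel 1997 §5.14 is the one-variable dictionary);
* **holomorphic** `V`-valued functions on `𝔹²` (`BallForms.holomorphic V`: the zero extension to
  `ℂ²` is `ℂ`-differentiable on the open ball), `BallForms.holFactorForms Δ A = factorForms Δ A ⊓
  holomorphic V`, and their image `BallForms.holWeightForms Δ hA` in the weight forms on `U(2,1)`
  (`mem_holWeightForms_iff`: `f` is holomorphic iff its ball function `ofGroup f` is, for ANY
  section) — the domain of the class maps of the Hodge dictionary;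
* sections of the orbit map at the base point exist (`BallForms.exists_section`, from the tree's
  `BallModel.exists_smul_x₀_eq`); they are what `factorFormsEquiv` takes as a PARAMETER.

For a datum `D : UnitaryBallUniformisationDatum 2 X` and a Sylvester frame `𝔣`:

* `D.ballRep 𝔣 : D.Γ →* U21` (`frameIso ∘ toRealPoints`; injective), equivariance of the chart
  `coneChart (γ v) = ballRep γ • coneChart v` (`coneChart_act`);
* the uniformization in the ball chart `D.ballUnifMap 𝔣 : 𝔹² → X(ℂ)`, `z ↦ unif (T (z,1))`:
  continuous, onto, `D.unif v = ballUnifMap (coneChart v)`, and **its fibres are exactly the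
  `Γ`-orbits**: `ballUnifMap z = ballUnifMap z' ↔ ∃ γ, ballRep γ • z = z'` (`ballUnifMap_eq_iff`,
  from the field `unif_eq_unif_iff`) — `X(ℂ) = Γ \ 𝔹²` in the affine model;
* `D.holAutForms 𝔣 Δ A := holFactorForms (Δ.map (D.ballRep 𝔣)) A` for `Δ ≤ D.Γ`.
-/

noncomputable section

open Matrix MulAction
open Literature.Geometry.ComplexHyperbolic
open Literature.Geometry.ComplexHyperbolic.BallModel (U21 Ball Jac x₀ nsq)
open Literature.NumberTheory.Automorphic.AutomorphyFactor

namespace Literature.AlgebraicGeometry.ShimuraVarieties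

/-! ### Cocycles on the ball -/

namespace BallForms

/-- The **cotangent cocycle** `(g, z) ↦ (Jac g z)ᵀ` acting on `ℂ²` (coefficients of `(1,0)`-forms:
`γ^*(Σ Fᵢ dzᵢ) = Σⱼ ((Jac γ z)ᵀ F(γ z))ⱼ dzⱼ`). [cite: Borel1997, §5.14] -/
def cotangentCocycle : U21 → Ball → Module.End ℂ (Fin 2 → ℂ) :=
  matrixCocycle fun g z ↦ (Jac g z)ᵀ

/-- `cotangentCocycle g z v = (Jac g z)ᵀ v`. [folklore] -/
@[simp] theorem cotangentCocycle_apply (g : U21) (z : Ball) (v : Fin 2 → ℂ) :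
    cotangentCocycle g z v = (Jac g z)ᵀ *ᵥ v :=
  matrixCocycle_apply _ g z v

/-- `(Jac 1 z)ᵀ = 1`. [folklore] -/
theorem transpose_Jac_one (z : Ball) : (Jac 1 z)ᵀ = 1 := by
  rw [BallModel.Jac_one, transpose_one]

/-- The transposed chain rule `(Jac (gh) z)ᵀ = (Jac h z)ᵀ (Jac g (hz))ᵀ`. [folklore] -/
theorem transpose_Jac_mul (g h : U21) (z : Ball) :
    (Jac (g * h) z)ᵀ = (Jac h z)ᵀ * (Jac g (h • z))ᵀ := by
  rw [BallModel.Jac_mul, transpose_mul]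

/-- The cotangent cocycle is a pullback cocycle. [cite: Borel1997, §5.14] -/
theorem isPullbackCocycle_cotangentCocycle : IsPullbackCocycle cotangentCocycle :=
  isPullbackCocycle_matrixCocycle transpose_Jac_one transpose_Jac_mul

/-- The **canonical automorphy factor** `j(g, z) = det Jac g z`. [cite: Borel1997, §5.14] -/
def canonicalFactor (g : U21) (z : Ball) : ℂ := (Jac g z).det

/-- `j(1, z) = 1`. [folklore] -/
@[simp] theorem canonicalFactor_one (z : Ball) : canonicalFactor 1 z = 1 := by
  rw [canonicalFactor, BallModel.Jac_one, det_one]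

/-- The cocycle identity `j(gh, z) = j(h, z) j(g, hz)`. [folklore] -/
theorem canonicalFactor_mul (g h : U21) (z : Ball) :
    canonicalFactor (g * h) z = canonicalFactor h z * canonicalFactor g (h • z) := by
  rw [canonicalFactor, BallModel.Jac_mul, det_mul, mul_comm]
  rfl

/-- `j(g, z) ≠ 0`. [folklore] -/
theorem canonicalFactor_ne_zero (g : U21) (z : Ball) : canonicalFactor g z ≠ 0 :=
  BallModel.det_Jac_ne_zero g z

/-- `g ↦ j(g, z)` is continuous. [folklore] -/
theorem continuous_canonicalFactor (z : Ball) : Continuous fun g : U21 ↦ canonicalFactor g z :=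
  (continuous_id.matrix_det).comp (BallModel.continuous_Jac z)

/-- The **canonical cocycle of weight `k`**, `(g, z) ↦ j(g, z)ᵏ • 1` on any `ℂ`-module `V`
(`k = 1`, `V = ℂ`: coefficients of `(2,0)`-forms `F dz₀ ∧ dz₁`). [cite: Borel1997, §5.14] -/
def canonicalCocycle (V : Type*) [AddCommGroup V] [Module ℂ V] (k : ℕ) :
    U21 → Ball → Module.End ℂ V :=
  scalarCocycle V fun g z ↦ canonicalFactor g z ^ k

/-- `canonicalCocycle V k g z v = j(g,z)ᵏ • v`. [folklore] -/
@[simp] theorem canonicalCocycle_apply (V : Type*) [AddCommGroup V] [Module ℂ V] (k : ℕ)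
    (g : U21) (z : Ball) (v : V) : canonicalCocycle V k g z v = canonicalFactor g z ^ k • v :=
  scalarCocycle_apply _ g z v

/-- The canonical cocycles are pullback cocycles. [cite: Borel1997, §5.14] -/
theorem isPullbackCocycle_canonicalCocycle (V : Type*) [AddCommGroup V] [Module ℂ V] (k : ℕ) :
    IsPullbackCocycle (canonicalCocycle V k) :=
  isPullbackCocycle_scalarCocycle (fun z ↦ by simp) fun g h z ↦ by
    rw [canonicalFactor_mul, mul_pow]

/-! ### Sections of the orbit map -/

/-- **Sections exist**: there is `s : 𝔹² → U(2,1)` with `s z • x₀ = z` (transitivity). Kept as a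
statement; consumers take a section as a parameter. [folklore] -/
theorem exists_section : ∃ s : Ball → U21, ∀ z, s z • x₀ = z :=
  ⟨fun z ↦ (BallModel.exists_smul_x₀_eq z).choose,
    fun z ↦ (BallModel.exists_smul_x₀_eq z).choose_spec⟩

/-! ### Holomorphic functions on the ball -/

/-- The open unit ball of `ℂ²` as a subset (`Ball` is its subtype). [folklore] -/
def ballSet : Set (Fin 2 → ℂ) := {w | nsq w < 1}

/-- The ball is open in `ℂ²` (`nsq` is continuous). [folklore] -/
theorem isOpen_ballSet : IsOpen ballSet :=
  isOpen_lt (by unfold BallModel.nsq; fun_prop) continuous_const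

/-- Points of `Ball` lie in `ballSet`. [folklore] -/
theorem coe_mem_ballSet (z : Ball) : z.1 ∈ ballSet := z.2

section Holomorphic

variable (V : Type*) [NormedAddCommGroup V]

/-- Extension by zero of a function on the ball to `ℂ²`. [folklore] -/
def extend (F : Ball → V) : (Fin 2 → ℂ) → V :=
  fun w ↦ if h : nsq w < 1 then F ⟨w, h⟩ else 0

variable {V}

/-- On the ball the extension is the function. [folklore] -/
@[simp] theorem extend_apply_coe (F : Ball → V) (z : Ball) : extend V F z.1 = F z := by
  simp [extend, z.2]

/-- `extend` is additive. [folklore] -/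
theorem extend_add (F G : Ball → V) : extend V (F + G) = extend V F + extend V G := by
  funext w
  by_cases h : nsq w < 1 <;> simp [extend, h]

/-- `extend 0 = 0`. [folklore] -/
@[simp] theorem extend_zero : extend V (0 : Ball → V) = 0 := by
  funext w
  by_cases h : nsq w < 1
  · simp only [extend, dif_pos h]; rfl
  · simp [extend, h]

variable [NormedSpace ℂ V]

/-- `extend` is homogeneous. [folklore] -/
theorem extend_smul (c : ℂ) (F : Ball → V) : extend V (c • F) = c • extend V F := by
  funext w
  by_cases h : nsq w < 1 <;> simp [extend, h]

variable (V)

/-- **Holomorphic `V`-valued functions on `𝔹²`**: the zero extension is `ℂ`-differentiable on the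
open ball. [folklore] -/
def holomorphic : Submodule ℂ (Ball → V) where
  carrier := {F | DifferentiableOn ℂ (extend V F) ballSet}
  add_mem' {F G} hF hG := by
    change DifferentiableOn ℂ (extend V (F + G)) ballSet
    rw [extend_add]
    exact hF.add hG
  zero_mem' := by
    change DifferentiableOn ℂ (extend V 0) ballSet
    rw [extend_zero]
    exact differentiableOn_const 0
  smul_mem' c F hF := by
    change DifferentiableOn ℂ (extend V (c • F)) ballSet
    rw [extend_smul]
    exact hF.const_smul c

variable {V}

/-- Membership in `holomorphic V`. [folklore] -/
theorem mem_holomorphic_iff {F : Ball → V} :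
    F ∈ holomorphic V ↔ DifferentiableOn ℂ (extend V F) ballSet :=
  Iff.rfl

/-- A holomorphic function is differentiable at every point of the (open) ball. [folklore] -/
theorem differentiableAt_extend {F : Ball → V} (hF : F ∈ holomorphic V) (z : Ball) :
    DifferentiableAt ℂ (extend V F) z.1 :=
  hF.differentiableAt (isOpen_ballSet.mem_nhds z.2)

/-- Holomorphic functions on the ball are continuous. [folklore] -/
theorem continuous_of_mem_holomorphic {F : Ball → V} (hF : F ∈ holomorphic V) : Continuous F := by
  have h : F = fun z : Ball ↦ extend V F z.1 := funext fun z ↦ (extend_apply_coe F z).symm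
  rw [h]
  exact hF.continuousOn.comp_continuous continuous_subtype_val coe_mem_ballSet

variable (V)

/-- **Holomorphic automorphic forms** for a cocycle `A` and a group `Δ ≤ U(2,1)`:
`factorForms Δ A ⊓ holomorphic V`. [cite: Borel1997, §5.14] -/
def holFactorForms {W : Type*} [NormedAddCommGroup W] [NormedSpace ℂ W] (Δ : Subgroup U21)
    (A : U21 → Ball → Module.End ℂ W) : Submodule ℂ (Ball → W) :=
  factorForms Δ A ⊓ holomorphic W

/-- Membership in `holFactorForms`. [folklore] -/
theorem mem_holFactorForms_iff {W : Type*} [NormedAddCommGroup W] [NormedSpace ℂ W]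
    {Δ : Subgroup U21} {A : U21 → Ball → Module.End ℂ W} {F : Ball → W} :
    F ∈ holFactorForms Δ A ↔ F ∈ factorForms Δ A ∧ F ∈ holomorphic W :=
  Submodule.mem_inf

/-- `holFactorForms` is antitone in the group. [folklore] -/
theorem holFactorForms_anti {W : Type*} [NormedAddCommGroup W] [NormedSpace ℂ W]
    {Δ Δ' : Subgroup U21} (h : Δ ≤ Δ') (A : U21 → Ball → Module.End ℂ W) :
    holFactorForms Δ' A ≤ holFactorForms Δ A :=
  inf_le_inf_right _ (factorForms_anti (A := A) h)

/-- **Holomorphic weight forms on the group**: the image of `holFactorForms Δ A` under the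
dictionary `toGroup` of `AutomorphyFactorForms` (weight `weightOf x₀` for the isotropy group
`K = Stab(x₀)`); the domain of the class maps of the Hodge dictionary. [cite: Borel1997, §5.14] -/
def holWeightForms {W : Type*} [NormedAddCommGroup W] [NormedSpace ℂ W] (Δ : Subgroup U21)
    {A : U21 → Ball → Module.End ℂ W} (hA : IsPullbackCocycle A) :
    Submodule ℂ
      (Literature.NumberTheory.Automorphic.weightForms Δ (stabilizer U21 x₀).subtype
        (hA.weightOf x₀)) :=
  ((holFactorForms Δ A).comap (factorForms Δ A).subtype).map (toGroup hA x₀)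

/-- **Characterisation through any section**: a weight form is holomorphic iff its ball function
`ofGroup f` (`= factorFormsEquiv.symm f`) is. [cite: Borel1997, Lemma 5.13 and §5.14] -/
theorem mem_holWeightForms_iff {W : Type*} [NormedAddCommGroup W] [NormedSpace ℂ W]
    {Δ : Subgroup U21} {A : U21 → Ball → Module.End ℂ W} (hA : IsPullbackCocycle A)
    {s : Ball → U21} (hs : ∀ z, s z • x₀ = z)
    {f : Literature.NumberTheory.Automorphic.weightForms Δ (stabilizer U21 x₀).subtype
      (hA.weightOf x₀)} :
    f ∈ holWeightForms Δ hA ↔ ((factorFormsEquiv hA hs).symm f : Ball → W) ∈ holomorphic W := by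
  constructor
  · rintro ⟨F, hF, rfl⟩
    rw [← factorFormsEquiv_apply hA hs, LinearEquiv.symm_apply_apply]
    exact (Submodule.mem_inf.1 hF).2
  · intro hf
    refine ⟨(factorFormsEquiv hA hs).symm f, Submodule.mem_inf.2 ⟨((factorFormsEquiv hA hs).symm
      f).2, hf⟩, ?_⟩
    rw [← factorFormsEquiv_apply hA hs, LinearEquiv.apply_symm_apply]

end Holomorphic

end BallForms

/-! ### The datum in the ball model -/

namespace UnitaryBallUniformisationDatum

open Literature.AlgebraicGeometry.Motives (SchemeOver ComplexPoints)

variable {X₂ : SchemeOver ℂ} (D₂ : UnitaryBallUniformisationDatum 2 X₂)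

/-- **`Γ → U(2,1)`** in a Sylvester frame: `γ ↦ T⁻¹ γ^{τ₁} T`.
[cite: BergeronMillsonMoeglin2016Balls, Part 2 §1.2] -/
def ballRep (𝔣 : D₂.SylvesterFrame) : D₂.Γ →* U21 :=
  (D₂.frameIso 𝔣).toMonoidHom.comp D₂.toRealPoints

/-- `ballRep γ = frameIso (toRealPoints γ)`. [folklore] -/
theorem ballRep_apply (𝔣 : D₂.SylvesterFrame) (γ : D₂.Γ) :
    D₂.ballRep 𝔣 γ = D₂.frameIso 𝔣 (D₂.toRealPoints γ) :=
  rfl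

/-- `ballRep` is injective. [folklore] -/
theorem ballRep_injective (𝔣 : D₂.SylvesterFrame) : Function.Injective (D₂.ballRep 𝔣) :=
  (D₂.frameIso 𝔣).injective.comp D₂.toRealPoints_injective

/-- The matrix of `ballRep γ`: `T⁻¹ γ^{τ₁} T`. [folklore] -/
theorem mat_ballRep (𝔣 : D₂.SylvesterFrame) (γ : D₂.Γ) :
    BallModel.mat (D₂.ballRep 𝔣 γ) =
      𝔣.ti * ((γ : GL (Fin 3) D₂.E) : Matrix (Fin 3) (Fin 3) D₂.E).map D₂.τ₁ * 𝔣.t := by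
  rw [ballRep_apply, mat_frameIso, coe_toRealPoints]

/-- **Equivariance of the chart for `Γ`**: `coneChart (γ v) = ballRep γ • coneChart v`.
[cite: BergeronMillsonMoeglin2016Balls, Part 2 §1.3] -/
theorem coneChart_act (𝔣 : D₂.SylvesterFrame) (γ : D₂.Γ) (v : D₂.cone) :
    D₂.coneChart 𝔣 (D₂.toRealPoints γ • v) = D₂.ballRep 𝔣 γ • D₂.coneChart 𝔣 v :=
  D₂.coneChart_smul 𝔣 (D₂.toRealPoints γ) v

/-! ### The uniformization in the ball chart -/

/-- **The uniformization on the affine ball**: `z ↦ unif (T (z, 1))`.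
[cite: BergeronMillsonMoeglin2016Balls, Introduction §1.1] -/
def ballUnifMap (𝔣 : D₂.SylvesterFrame) (z : Ball) : ComplexPoints X₂ :=
  D₂.unif (D₂.coneLift 𝔣 z)

/-- `ballUnifMap z = unif (coneLift z)`. [folklore] -/
theorem ballUnifMap_apply (𝔣 : D₂.SylvesterFrame) (z : Ball) :
    D₂.ballUnifMap 𝔣 z = D₂.unif (D₂.coneLift 𝔣 z) :=
  rfl

/-- `unif` is constant on the fibres of the chart. [folklore] -/
theorem unif_eq_of_coneChart_eq (𝔣 : D₂.SylvesterFrame) {v w : D₂.cone}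
    (h : D₂.coneChart 𝔣 v = D₂.coneChart 𝔣 w) : D₂.unif v = D₂.unif w := by
  obtain ⟨c, hc, hvw⟩ := (D₂.coneChart_eq_iff 𝔣 v w).1 h
  rw [hvw]
  exact D₂.unif_smul hc w.2

/-- **`unif` factors through the chart**: `unif v = ballUnifMap (coneChart v)`.
[cite: BergeronMillsonMoeglin2016Balls, Introduction §1.1] -/
theorem unif_eq_ballUnifMap_coneChart (𝔣 : D₂.SylvesterFrame) (v : D₂.cone) :
    D₂.unif v = D₂.ballUnifMap 𝔣 (D₂.coneChart 𝔣 v) := by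
  rw [ballUnifMap_apply]
  exact D₂.unif_eq_of_coneChart_eq 𝔣 (D₂.coneChart_coneLift 𝔣 _).symm

/-- `ballUnifMap` is onto `X(ℂ)`. [cite: BergeronMillsonMoeglin2016Balls, Introduction §1.1] -/
theorem ballUnifMap_surjective (𝔣 : D₂.SylvesterFrame) :
    Function.Surjective (D₂.ballUnifMap 𝔣) := by
  intro P
  obtain ⟨v, hv, hP⟩ := D₂.surjOn_unif (Set.mem_univ P)
  exact ⟨D₂.coneChart 𝔣 ⟨v, hv⟩, by rw [← unif_eq_ballUnifMap_coneChart]; exact hP⟩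

/-- `coneLift` is continuous. [folklore] -/
theorem continuous_coneLift (𝔣 : D₂.SylvesterFrame) : Continuous (D₂.coneLift 𝔣) := by
  refine Continuous.subtype_mk ?_ _
  refine continuous_const.matrix_mulVec ?_
  refine continuous_pi fun i ↦ ?_
  fin_cases i
  · show Continuous fun z : Ball ↦ z.1 0
    exact (continuous_apply 0).comp continuous_subtype_val
  · show Continuous fun z : Ball ↦ z.1 1
    exact (continuous_apply 1).comp continuous_subtype_val
  · show Continuous fun _ : Ball ↦ (1 : ℂ)
    exact continuous_const

/-- `ballUnifMap` is continuous. [cite: BergeronMillsonMoeglin2016Balls, Introduction §1.1] -/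
theorem continuous_ballUnifMap (𝔣 : D₂.SylvesterFrame) : Continuous (D₂.ballUnifMap 𝔣) := by
  have h : D₂.ballUnifMap 𝔣 = D₂.cone.restrict D₂.unif ∘ D₂.coneLift 𝔣 := rfl
  rw [h]
  exact D₂.continuousOn_unif.restrict.comp (D₂.continuous_coneLift 𝔣)

/-- **The fibres of the uniformization are the `Γ`-orbits**:
`ballUnifMap z = ballUnifMap z' ↔ ∃ γ ∈ Γ, ballRep γ • z = z'`.
[cite: BergeronMillsonMoeglin2016Balls, Introduction §1.1] -/
theorem ballUnifMap_eq_iff (𝔣 : D₂.SylvesterFrame) (z z' : Ball) :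
    D₂.ballUnifMap 𝔣 z = D₂.ballUnifMap 𝔣 z' ↔ ∃ γ : D₂.Γ, D₂.ballRep 𝔣 γ • z = z' := by
  rw [ballUnifMap_apply, ballUnifMap_apply,
    D₂.unif_eq_unif_iff _ (D₂.coneLift 𝔣 z).2 _ (D₂.coneLift 𝔣 z').2]
  constructor
  · rintro ⟨γ, hγ, c, hc, h⟩
    refine ⟨⟨γ, hγ⟩, ?_⟩
    have h' : ((D₂.toRealPoints ⟨γ, hγ⟩ • D₂.coneLift 𝔣 z : D₂.cone) : Fin 3 → ℂ) =
        c • (D₂.coneLift 𝔣 z' : Fin 3 → ℂ) := h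
    have hch : D₂.coneChart 𝔣 (D₂.toRealPoints ⟨γ, hγ⟩ • D₂.coneLift 𝔣 z) =
        D₂.coneChart 𝔣 (D₂.coneLift 𝔣 z') :=
      (D₂.coneChart_eq_iff 𝔣 _ _).2 ⟨c, hc, h'⟩
    rwa [coneChart_act, coneChart_coneLift, coneChart_coneLift] at hch
  · rintro ⟨γ, h⟩
    have hch : D₂.coneChart 𝔣 (D₂.toRealPoints γ • D₂.coneLift 𝔣 z) =
        D₂.coneChart 𝔣 (D₂.coneLift 𝔣 z') := by
      rw [coneChart_act, coneChart_coneLift, coneChart_coneLift, h]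
    obtain ⟨c, hc, h'⟩ := (D₂.coneChart_eq_iff 𝔣 _ _).1 hch
    exact ⟨γ, γ.2, c, hc, h'⟩

/-- `ballUnifMap` is `Γ`-invariant. [cite: BergeronMillsonMoeglin2016Balls, Introduction §1.1] -/
theorem ballUnifMap_smul (𝔣 : D₂.SylvesterFrame) (γ : D₂.Γ) (z : Ball) :
    D₂.ballUnifMap 𝔣 (D₂.ballRep 𝔣 γ • z) = D₂.ballUnifMap 𝔣 z :=
  ((D₂.ballUnifMap_eq_iff 𝔣 z _).2 ⟨γ, rfl⟩).symm

/-! ### Holomorphic automorphic forms of the datum -/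

/-- **Holomorphic automorphic forms of level `Δ ≤ Γ` for the cocycle `A`** on the ball, in the
frame `𝔣`: `holFactorForms (Δ.map ballRep) A`. [cite: BergeronMillsonMoeglin2016Balls, Part 2 §1.3]
[cite: Borel1997, §5.14] -/
def holAutForms {W : Type*} [NormedAddCommGroup W] [NormedSpace ℂ W] (𝔣 : D₂.SylvesterFrame)
    (Δ : Subgroup D₂.Γ) (A : U21 → Ball → Module.End ℂ W) : Submodule ℂ (Ball → W) :=
  BallForms.holFactorForms (Δ.map (D₂.ballRep 𝔣)) A

/-- Shrinking the level enlarges the space of forms. [folklore] -/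
theorem holAutForms_anti {W : Type*} [NormedAddCommGroup W] [NormedSpace ℂ W]
    (𝔣 : D₂.SylvesterFrame) {Δ Δ' : Subgroup D₂.Γ} (h : Δ ≤ Δ')
    (A : U21 → Ball → Module.End ℂ W) : D₂.holAutForms 𝔣 Δ' A ≤ D₂.holAutForms 𝔣 Δ A :=
  BallForms.holFactorForms_anti (Subgroup.map_mono h) A

end UnitaryBallUniformisationDatum

end Literature.AlgebraicGeometry.ShimuraVarieties

end
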